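import Mathlib
import Summits.MatrixMultiplication.MatrixMultiplication.Theses.AutomaticSTPPDesigns
import Summits.MatrixMultiplication.MatrixMultiplication.Theses.GroupTheoreticSTPP
import Summits.MatrixMultiplication.MatrixMultiplication.Theorems.AutomaticSTPPDesignsRegularTowerGap
import Summits.MatrixMultiplication.MatrixMultiplication.Theorems.AutomaticSTPPDesignsAutomaticPackingThesisNormalForm
import Summits.MatrixMultiplication.MatrixMultiplication.Theorems.AutomaticSTPPDesignsAutomaticPackingThesisCyclicCalibration080
import Summits.MatrixMultiplication.MatrixMultiplication.Theorems.AutomaticSTPPDesignsAutomaticPackingThesisCruxGivesCThesis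
import Summits.MatrixMultiplication.MatrixMultiplication.Theorems.AutomaticSTPPDesignsAutomaticPackingThesisTwoFamiliesBridge
import Summits.MatrixMultiplication.MatrixMultiplication.Theorems.AutomaticSTPPDesignsAutomaticPackingThesisRankNormalForm
import Summits.MatrixMultiplication.MatrixMultiplication.Theorems.AutomaticSTPPDesignsSingleAutomatonRigidity

/-!
# STRATEGY CENSUS (typed part) — crux `AutomaticPackingThesis` (stmt-MatrixMultiplication-7356)

Crux-strategist sketch file: the typed statements quoted in `STRATEGY-CENSUS.md`
(Transfer / Strengthen / Decomposition / Negation), with the cheap implications kernel-checked.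
Nothing here is a registered stub; `sorry` only where marked OPEN.
-/

set_option linter.dupNamespace false
set_option linter.unusedVariables false

namespace Summit.MatrixMultiplication.MatrixMultiplication.Cruxes.AutomaticPackingThesis.Census

open Finset Literature.Combinatorics.Additive Literature.Computability.AlgebraicComplexity
open Summit.MatrixMultiplication.MatrixMultiplication.Theses.AutomaticSTPPDesigns
open Summit.MatrixMultiplication.MatrixMultiplication.Theses.GroupTheoreticSTPP
open Summit.MatrixMultiplication.MatrixMultiplication.Theorems.AutomaticPackingThesis

open scoped Classical

/-! ## The residual (lead's open stub, ≡ crux by `automaticPackingThesis_iff_cyclicBeat`) -/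

/-- `Beat τ`: some STPP design in some cyclic `ℤ/p^K` (`p ≥ 2`) beats its host at exponent `τ`. -/
def Beat (τ : ℝ) : Prop :=
  ∃ (p K n : ℕ) (_ : 2 ≤ p) (A B C : Fin n → Finset (ZMod (p ^ K))),
    IsSTPP A B C ∧ (p : ℝ) ^ K < ∑ i, (((A i).card * (B i).card * (C i).card : ℕ) : ℝ) ^ τ

/-- The residual: `∀ τ > 2/3, Beat τ` (= `stub_cyclicBeat`). -/
def CyclicBeat : Prop := ∀ τ : ℝ, 2 / 3 < τ → Beat τ

theorem crux_iff_cyclicBeat : AutomaticPackingThesis ↔ CyclicBeat :=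
  automaticPackingThesis_iff_cyclicBeat

/-- Monotonicity of `Beat` in the exponent (blocks of size `0` contribute `0`, others `≥ 1`). -/
theorem Beat.mono {τ τ' : ℝ} (hτ : 0 < τ) (hle : τ ≤ τ') (h : Beat τ) : Beat τ' := by
  obtain ⟨p, K, n, hp, A, B, C, hS, hlt⟩ := h
  refine ⟨p, K, n, hp, A, B, C, hS, lt_of_lt_of_le hlt (Finset.sum_le_sum fun i _ => ?_)⟩
  rcases Nat.eq_zero_or_pos ((A i).card * (B i).card * (C i).card) with hz | hpos
  · rw [hz, Nat.cast_zero, Real.zero_rpow hτ.ne', Real.zero_rpow (by linarith)]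
  · exact Real.rpow_le_rpow_of_exponent_le (by exact_mod_cast hpos) hle

/-- Theorem-level calibration in the tree: the residual holds on `[4/5, ∞)` (crux #2, sliced CW). -/
theorem beat_of_ge080 (τ : ℝ) (hτ : (4 : ℝ) / 5 ≤ τ) : Beat τ := cyclicBeat_of_ge080 τ hτ

/-! ## STRENGTHEN

(S1) single seed for all `ε` (one automaton / one regular tower): REFUTED by the tree theorem
`regularTowerGap_proof` (infimum-not-minimum along one regular tower). -/

/-- (S1) `SingleSeed`: ONE base and ONE triple of regular languages, STPP at all scales, beating
`p^k` at exponent `(2+ε)/3` infinitely often for EVERY `ε > 0` — the crux with `∀ ε` moved inside. -/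
def SingleSeed : Prop :=
  ∃ (p : ℕ) (ι : Type) (_ : Fintype ι) (LA LB LC : Language (ι × Fin p)), 2 ≤ p ∧ LA.IsRegular ∧ LB.IsRegular ∧ LC.IsRegular ∧ (let blk := fun (k : ℕ) (L : Language (ι × Fin p)) (w : Fin k → ι) => ((Finset.univ : Finset (Fin k → Fin p)).filter (fun a => List.ofFn (fun j : Fin k => (w j, a j)) ∈ L)).image (fun a : Fin k → Fin p => ((∑ j : Fin k, (a j : ℕ) * p ^ (j : ℕ) : ℕ) : ZMod (p ^ k))); (∀ k : ℕ, AddSimultaneousTPP (blk k LA) (blk k LB) (blk k LC)) ∧ ∀ ε : ℝ, 0 < ε → ∀ k₀ : ℕ, ∃ k ≥ k₀, (p : ℝ) ^ k < ∑ w : Fin k → ι, (((blk k LA w).card * (blk k LB w).card * (blk k LC w).card : ℕ) : ℝ) ^ ((2 + ε) / 3))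

/-- `SingleSeed` is the natural INDUCTIVE strengthening of the crux and it is FALSE: kernel-checked
from the route's proved crux #3 `RegularTowerGap`. -/
theorem not_singleSeed : ¬ SingleSeed := by
  rintro ⟨p, ι, _, LA, LB, LC, hp, hA, hB, hC, hS, hbeat⟩
  obtain ⟨ε, hε, k₀, hk₀⟩ :=
    Summit.MatrixMultiplication.MatrixMultiplication.Theorems.RegularTowerGap.regularTowerGap_proof
      p ι LA LB LC hp hA hB hC hS
  obtain ⟨k, hk, hlt⟩ := hbeat ε hε k₀
  exact absurd (hk₀ k hk) (not_le.mpr hlt)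

/-- `SingleSeed` would have given the crux (so its failure is informative, not fatal). -/
theorem crux_of_singleSeed (h : SingleSeed) : AutomaticPackingThesis := by
  obtain ⟨p, ι, hι, LA, LB, LC, hp, hA, hB, hC, hS, hbeat⟩ := h
  exact ⟨p, hp, fun ε hε => ⟨ι, hι, LA, LB, LC, hA, hB, hC, hS, hbeat ε hε⟩⟩

/-! (S2) CKSU Conj 4.7 (`CPackingConstruction`, stmt-0595) ⟹ crux: tree theorem. -/
theorem crux_of_twoFamilies : CPackingConstruction → AutomaticPackingThesis := stub_twoFamiliesBridge

/-! (S3) strengthen-to-induct: an exponent-IMPROVING step.  For any `g` with `2/3 < g τ < 1` whose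
iterates from `4/5` go below every `τ > 2/3`, `ImprovementStep g` is EQUIVALENT to the crux
(modulo the tree's rung `4/5`), i.e. it is the crux re-worded, not a piece of it. -/

/-- (S3) an exponent-improving operation on cyclic designs. -/
def ImprovementStep (g : ℝ → ℝ) : Prop := ∀ τ : ℝ, 2 / 3 < τ → τ < 1 → Beat τ → Beat (g τ)

theorem improvementStep_of_crux (g : ℝ → ℝ) (hg : ∀ τ : ℝ, 2 / 3 < τ → τ < 1 → 2 / 3 < g τ)
    (h : AutomaticPackingThesis) : ImprovementStep g := fun τ h₁ h₂ _ =>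
  (crux_iff_cyclicBeat.mp h) (g τ) (hg τ h₁ h₂)

theorem crux_of_improvementStep (g : ℝ → ℝ)
    (hg : ∀ τ : ℝ, 2 / 3 < τ → τ < 1 → 2 / 3 < g τ ∧ g τ < 1)
    (hiter : ∀ τ : ℝ, 2 / 3 < τ → ∃ m : ℕ, g^[m] (4 / 5) ≤ τ)
    (h : ImprovementStep g) : AutomaticPackingThesis := by
  -- every iterate of `g` from `4/5` stays in `(2/3, 1)` and is beaten
  have key : ∀ m : ℕ, 2 / 3 < g^[m] (4 / 5) ∧ g^[m] (4 / 5) < 1 ∧ Beat (g^[m] (4 / 5)) := by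
    intro m
    induction m with
    | zero =>
      refine ⟨by norm_num, by norm_num, ?_⟩
      simpa using beat_of_ge080 (4 / 5) le_rfl
    | succ m ih =>
      obtain ⟨h₁, h₂, hb⟩ := ih
      rw [Function.iterate_succ_apply']
      exact ⟨(hg _ h₁ h₂).1, (hg _ h₁ h₂).2, h _ h₁ h₂ hb⟩
  rw [crux_iff_cyclicBeat]
  intro τ hτ
  obtain ⟨m, hm⟩ := hiter τ hτ
  obtain ⟨h₁, -, hb⟩ := key m
  exact hb.mono (by linarith) hm

/-! ## DECOMPOSITION

(D-a) seed ∧ amplify.  Every amplifier in the tree is exponent-NEUTRAL (concatenation powers,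
CRT, block tensors, chart powers: ratio ↦ ratio^m at the SAME τ), so the seed piece at `τ` is
`Beat τ` itself; the only exponent-improving amplifier known (laser refinement) is (S3).

(D-b) the bridge split through route C's thesis `CThesis` (X_C, stmt-0593): -/

/-- (D-b) piece 2: universality of cyclic hosts among finite abelian hosts ("every abelian STPP
packing beating its host can be re-hosted cyclically at an exponent loss → 0"). OPEN; the tree has
only the mixed-radix transfer with host loss `3^rank` (`stub_rankBeatNormalForm`). -/
def CyclicUniversality : Prop := CThesis → AutomaticPackingThesis

/-- The seam of (D-b) is modus ponens (trivial_seam); piece 1 is route C's target (open, famous),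
piece 2 has no mechanism: the split relocates the difficulty, it does not cut it. -/
theorem crux_of_bridge (h₁ : CThesis) (h₂ : CyclicUniversality) : AutomaticPackingThesis := h₂ h₁

/-- Converse bookkeeping: the crux implies both pieces (piece 1 by `stub_cruxGivesCThesis`). -/
theorem bridge_of_crux (h : AutomaticPackingThesis) : CThesis ∧ CyclicUniversality :=
  ⟨stub_cruxGivesCThesis h, fun _ => h⟩

/-- (D-c) the rank normal form (tree): designs in homocyclic `(ℤ/N)^R` beating `3^R N^R`. -/
theorem crux_iff_rankBeat : AutomaticPackingThesis ↔ ∀ τ : ℝ, 2 / 3 < τ → ∃ (N R n : ℕ) (_ : 1 ≤ N) (_ : 1 ≤ R) (A B C : Fin n → Finset (Fin R → ZMod N)), IsSTPP A B C ∧ (3 : ℝ) ^ R * (N : ℝ) ^ R < ∑ i, (((A i).card * (B i).card * (C i).card : ℕ) : ℝ) ^ τ :=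
  stub_rankBeatNormalForm

/-! ## TRANSFER

(T1) the solved sibling `M = 1` (tricolored sum-free sets in `ℤ/N`, Behrend): thickening a point
to a brick by TRANSLATION is worth exactly one brick — translate designs never beat below `τ = 1`.
-/

/-- (T1) **Translate designs are worth one block.** If all `A_i` are translates of one set `A`,
all `B_i` of `B`, all `C_i` of `C`, then `n · |A||B||C| ≤ |H|`: the map
`(i, a, b, c) ↦ (x_i − z_i) + a + b + c` is injective by the STPP instances `(i, i, k)`.
Hence `∑_i (|A_i||B_i||C_i|)^τ = n (|A||B||C|)^τ ≤ |H| · (|A||B||C|)^{τ-1} ≤ |H|` for `τ ≤ 1`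
(cf. summit card `stpp-shape-diversity-law`). -/
theorem translateDesign_volume_le {H : Type*} [AddCommGroup H] [Fintype H] [DecidableEq H]
    {n : ℕ} (A B C : Finset H) (x y z : Fin n → H)
    (h : IsSTPP (fun i => A.image (x i + ·)) (fun i => B.image (y i + ·))
      (fun i => C.image (z i + ·))) :
    n * (A.card * B.card * C.card) ≤ Fintype.card H := by
  classical
  let Φ : Fin n × (A × B × C) → H := fun q => (x q.1 - z q.1) + ((q.2.1 : H) + (q.2.2.1 : H) + (q.2.2.2 : H))
  have hinj : Function.Injective Φ := by
    rintro ⟨i, a, b, c⟩ ⟨k, a', b', c'⟩ heq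
    simp only [Φ] at heq
    -- the STPP instance with indices (i, j, k) := (i, i, k)
    have hrel : (x i + (a : H)) - (x k + (a' : H)) + ((y i + (b : H)) - (y i + (b' : H))) +
        ((z k + (c : H)) - (z i + (c' : H))) = 0 := by
      have : (x i + (a : H)) - (x k + (a' : H)) + ((y i + (b : H)) - (y i + (b' : H))) +
          ((z k + (c : H)) - (z i + (c' : H))) =
          ((x i - z i) + ((a : H) + (b : H) + (c : H))) - ((x k - z k) + ((a' : H) + (b' : H) + (c' : H))) := by
        abel
      rw [this, heq, sub_self]
    have hmemA : ∀ (j : Fin n) (d : A), x j + (d : H) ∈ A.image (x j + ·) :=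
      fun j d => Finset.mem_image.mpr ⟨d, d.2, rfl⟩
    have hmemB : ∀ (j : Fin n) (d : B), y j + (d : H) ∈ B.image (y j + ·) :=
      fun j d => Finset.mem_image.mpr ⟨d, d.2, rfl⟩
    have hmemC : ∀ (j : Fin n) (d : C), z j + (d : H) ∈ C.image (z j + ·) :=
      fun j d => Finset.mem_image.mpr ⟨d, d.2, rfl⟩
    obtain ⟨-, hik, hs, ht, hu⟩ := h i i k (x k + (a' : H)) (hmemA k a') (x i + (a : H)) (hmemA i a)
      (y i + (b' : H)) (hmemB i b') (y i + (b : H)) (hmemB i b) (z i + (c' : H)) (hmemC i c')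
      (z k + (c : H)) (hmemC k c) hrel
    subst hik
    have ha : (a' : H) = a := by simpa using hs
    have hb : (b' : H) = b := by simpa using ht
    have hc : (c' : H) = c := by simpa using hu
    simp [Prod.ext_iff, Subtype.ext_iff, ha, hb, hc]
  have := Fintype.card_le_of_injective Φ hinj
  simpa [Fintype.card_prod, Fintype.card_coe, mul_assoc] using this

/-! (T3) the solved rung `τ = 4/5` (CW level 1 sliced into `ℤ/8^k`, crux #2 PROVED): the next
rungs in print are CW level 2 / the refined laser (τ ≈ 0.7919 / 0.7905) — calibration of the
window only; typed target for whoever wants the rung: -/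

/-- (T3) rung `0.7919` (Coppersmith–Winograd 1990 level-2 bound `ω ≤ 2.375477`, to be sliced
into one cyclic group as crux #2 was): OPEN in the tree, provable in principle, irrelevant to
closing the crux (the laser family is capped at `ω_lim ≥ 2.3725`, Ambainis–Filmus–Le Gall 2015,
and every CW_q-based method at `2.16805`, Alman–Vassilevska Williams 2018). -/
def RungCWLevelTwo : Prop := ∀ τ : ℝ, (7919 : ℝ) / 10000 ≤ τ → Beat τ

theorem window_after_rung (h : RungCWLevelTwo)
    (hw : ∀ τ : ℝ, 2 / 3 < τ → τ < 7919 / 10000 → Beat τ) : AutomaticPackingThesis := by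
  rw [crux_iff_cyclicBeat]
  intro τ hτ
  by_cases hlt : τ < 7919 / 10000
  · exact hw τ hτ hlt
  · exact h τ (not_lt.mp hlt)

/-! ## NEGATION

Refutation normal form (tree): `¬crux ↔ ∃ τ₀ > 2/3, uniform ceiling at τ₀`; any `τ₀` must be
`< 4/5` (`not_uniformGap_of_ge080`); `¬crux ⟹ ¬CPackingConstruction` (contrapositive of
`stub_twoFamiliesBridge`); `CAbelianObstructionNeg ⟹ ¬crux`.  The weakest refuting SHAPE that is
consistent with Behrend (`M = 1`) and with CW (`η = M^{-0.4}`) is a ceiling polynomial in the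
block size: -/

/-- (N1) `PolyCeiling c`: every STPP design in a cyclic group whose `3n` blocks all have size `M`
packs with efficiency `n M² / N ≤ M^{-c}` (up to the constant `K`).  For any `c > 0` this REFUTES
the crux (uniform normal form, p124204) and CKSU Conj 4.7; no tool in print proves it for any
`c > 0` (slice rank void in `ℤ/N`; removal gives `o(1)` only; Val-type bounds restrict `M/N^{1/3}`
only).  `c = 1` holds for translate designs (T1). -/
def PolyCeiling (c : ℝ) : Prop :=
  ∃ K : ℝ, 0 < K ∧ ∀ (N n M : ℕ), 1 ≤ N → 2 ≤ M → ∀ (A B C : Fin n → Finset (ZMod N)),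
    IsSTPP A B C → (∀ i, (A i).card = M ∧ (B i).card = M ∧ (C i).card = M) →
      (n : ℝ) * (M : ℝ) ^ 2 ≤ K * (N : ℝ) * (M : ℝ) ^ (-c)

/-- (N2) the removal rung (tree, `uniformCriticalPackingDecay` / `stub_abelianSubPacking`):
efficiency `→ 0` uniformly, with Behrend-quality rate — the strongest ceiling known. -/
theorem removalRung : ∀ η : ℝ, 0 < η → ∃ N₀ : ℕ, ∀ (H : Type) [AddCommGroup H] [Fintype H],
    N₀ ≤ Fintype.card H → ∀ (ι : Type) [Fintype ι] (A B C : ι → Finset H),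
      AddSimultaneousTPP A B C →
        ∑ i, (((A i).card * (B i).card * (C i).card : ℕ) : ℝ) ^ ((2 : ℝ) / 3) <
          η * (Fintype.card H : ℝ) :=
  Summit.MatrixMultiplication.MatrixMultiplication.Theorems.uniformCriticalPackingDecay

end Summit.MatrixMultiplication.MatrixMultiplication.Cruxes.AutomaticPackingThesis.Census
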